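import Summits.RiemannHypothesis.RiemannHypothesis.Theorems.CofiniteCriticalLine.Negative.CollarCostume
import Summits.RiemannHypothesis.RiemannHypothesis.Theorems.RuelleBandLadderGlue
import HarnessLib

set_option linter.dupNamespace false

/-!
# Evidence (lead c2): both stubs of line `rate-band-collar-split` are crux-IMPLIED (kernel-checked), and the
line's own skeleton proves stub_far ∧ stub_near ⟹ crux — so the line is the exact split crux ⟺ (#4 ∧ NEAR).
-/

noncomputable section

open Complex Literature.NumberTheory.LFunctions

namespace Summit.RiemannHypothesis.RiemannHypothesis.Cruxes.CofiniteCriticalLine.RateBandCollarSplitEvidence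

open Summit.RiemannHypothesis.RiemannHypothesis.Theses.RuelleBand

/-- `stub_near` (verbatim statement of the registered stub) follows from the crux: `ε₀ := 1` in
`Negative.fixedCollarMono_of_cofinite` (p77656). -/
theorem stub_near_of_crux (h : CofiniteCriticalLine) :
    ∃ ε₀ : ℝ, 0 < ε₀ ∧ ∃ T : ℝ, ∀ t : ℝ, T ≤ |t| →
      MonotoneOn (fun x : ℝ => ‖riemannXi (1 / 2 + x + t * I)‖) (Set.Icc 0 ε₀) :=
  ⟨1, one_pos, Summit.RiemannHypothesis.Cruxes.CofiniteCriticalLine.Negative.fixedCollarMono_of_cofinite h 1⟩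

/-- `stub_far` (= rung #4, item stmt-RiemannHypothesis-2063) follows from the crux (ladder glue, item 2068 closed). -/
theorem stub_far_of_crux (h : CofiniteCriticalLine) : AsymptoticCriticalLine :=
  Summit.RiemannHypothesis.RiemannHypothesis.Theorems.ruelleBand_ladderGlue_proof.2 h

end Summit.RiemannHypothesis.RiemannHypothesis.Cruxes.CofiniteCriticalLine.RateBandCollarSplitEvidence

end
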